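import Summits.HubbardSuperconductivity.HubbardSuperconductivity.Theorems.SoloBlindCrutchAxis
import Literature.MathematicalPhysics.QuantumLattice.FreeFermionSectorGroundStates
import HarnessLib

/-!
# The variational principle on the BCS-crutch axis (solo-blind programme, Theorem 24(c))

The converse direction of the energy form (Theorem 24(b),
`groundState_re_rayleigh_ge_of_minEnergyOn_crutch_le`) packaged for a TRIAL STATE: if some nonzero
`Ψ` of the sector `K_L = (2n, S^z = 0)` has

  `re⟨Ψ, (H_L + (-t)·ΔᴴΔ) Ψ⟩ ≤ (min_{K_L} H_L - t·a) · ‖Ψ‖²`,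

then EVERY normalised ground state of `H_L - t ΔᴴΔ` in `K_L` has order `re⟨φ, ΔᴴΔ φ⟩ ≥ a`
(`crutch_groundState_order_ge_of_trial`, any `U`); at `U = 0` the reference energy is the free
Fermi-sea energy `2Σ_{k∈F} ε_k` of the sector (`free_crutch_groundState_order_ge_of_trial`); and a
family of trial states with depression `κ L²` at coupling `t = g/L²` for all large even sides gives
`HasLongRangeOrder` in the summit's exact shape for every family of sector ground states of
`H_L(g) = H_L - (g/L²)ΔᴴΔ` (`crutch_hasLongRangeOrder_of_trials`, order `≥ (κ/g)L⁴`).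

This is the assembly step E6b(iii) of claim C53 (report §5.20 (6)): with the bracket of
`SoloBlindEnergyBalance` and the window of `SoloBlindReciprocalBlocks` the remaining input is the
explicit trial state (E5c/E6b(ii)). [this work]
-/

noncomputable section

namespace Summit.HubbardSuperconductivity.HubbardSuperconductivity.Theorems.CrutchAxis

open Matrix Literature.Probability.LatticeModels Literature.MathematicalPhysics.QuantumLattice
open scoped ComplexOrder

variable {L : ℕ} [NeZero L]

/-- **Theorem 24(c) (variational order principle on the crutch axis).** A nonzero sector vector
whose crutched energy lies `t·a‖Ψ‖²` below the sector minimum of `H_L` forces order `≥ a` on every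
normalised sector ground state of `H_L + (-t)ΔᴴΔ`. [this work] -/
theorem crutch_groundState_order_ge_of_trial (U : ℝ) (n : ℕ) {t a : ℝ} (ht : 0 < t)
    {Ψ : Fock (Orb (FermionTorus 2 L))} (hΨK : Ψ ∈ szSector (Λ := FermionTorus 2 L) (2 * n) 0)
    (hΨ0 : Ψ ≠ 0)
    (hΨ : (star Ψ ⬝ᵥ (hubbardTorus 2 L 1 U + ((-t : ℝ) : ℂ) •
        ((pairField dWaveFormFactor L)ᴴ * pairField dWaveFormFactor L)) *ᵥ Ψ).re ≤
      ((hubbardTorus 2 L 1 U).minEnergyOn (szSector (Λ := FermionTorus 2 L) (2 * n) 0) - t * a) *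
        (star Ψ ⬝ᵥ Ψ).re)
    {φ : Fock (Orb (FermionTorus 2 L))} (hφ1 : star φ ⬝ᵥ φ = 1)
    (hφ : IsGroundStateInSector
      (hubbardTorus 2 L 1 U + ((-t : ℝ) : ℂ) •
        ((pairField dWaveFormFactor L)ᴴ * pairField dWaveFormFactor L)) (2 * n) 0 φ) :
    a ≤ (star φ ⬝ᵥ ((pairField dWaveFormFactor L)ᴴ * pairField dWaveFormFactor L) *ᵥ φ).re := by
  have hOh : ((pairField dWaveFormFactor L)ᴴ * pairField dWaveFormFactor L).IsHermitian :=
    isHermitian_conjTranspose_mul_self _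
  have hHh := isHermitian_hubbardTorus L 1 U
  have hAh := isHermitian_add_ofReal_smul hHh hOh (-t)
  have hpos : 0 < (star Ψ ⬝ᵥ Ψ).re := by
    have h := (Matrix.dotProduct_star_self_pos_iff).2 hΨ0
    have h' := (Complex.lt_def.1 h).1
    simpa using h'
  have hvar := minEnergyOn_mul_le_re_rayleigh hAh (szSector (Λ := FermionTorus 2 L) (2 * n) 0) hΨK
  have hE : (hubbardTorus 2 L 1 U + ((-t : ℝ) : ℂ) •
        ((pairField dWaveFormFactor L)ᴴ * pairField dWaveFormFactor L)).minEnergyOn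
          (szSector (Λ := FermionTorus 2 L) (2 * n) 0) ≤
      (hubbardTorus 2 L 1 U).minEnergyOn (szSector (Λ := FermionTorus 2 L) (2 * n) 0) - t * a :=
    le_of_mul_le_mul_right (hvar.trans hΨ) hpos
  exact groundState_re_rayleigh_ge_of_minEnergyOn_crutch_le hHh _ ht hE hφ.1 hφ1 hφ.2.2

/-- The `U = 0` case with the reference energy identified: the sector minimum of the free
Hamiltonian is the Fermi-sea energy `2Σ_{k∈F} ε_k` (`minEnergyOn_szSector_free_eq`). [this work] -/
theorem free_crutch_groundState_order_ge_of_trial (hL : 3 ≤ L) (F : Finset (TorusSite 2 L))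
    (μ : ℝ) (hF : ∀ k ∈ F, torusBand L k ≤ μ) (hF' : ∀ k ∉ F, μ ≤ torusBand L k) {t a : ℝ}
    (ht : 0 < t) {Ψ : Fock (Orb (FermionTorus 2 L))}
    (hΨK : Ψ ∈ szSector (Λ := FermionTorus 2 L) (2 * F.card) 0) (hΨ0 : Ψ ≠ 0)
    (hΨ : (star Ψ ⬝ᵥ (hubbardTorus 2 L 1 0 + ((-t : ℝ) : ℂ) •
        ((pairField dWaveFormFactor L)ᴴ * pairField dWaveFormFactor L)) *ᵥ Ψ).re ≤
      (2 * (∑ k ∈ F, torusBand L k) - t * a) * (star Ψ ⬝ᵥ Ψ).re)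
    {φ : Fock (Orb (FermionTorus 2 L))} (hφ1 : star φ ⬝ᵥ φ = 1)
    (hφ : IsGroundStateInSector
      (hubbardTorus 2 L 1 0 + ((-t : ℝ) : ℂ) •
        ((pairField dWaveFormFactor L)ᴴ * pairField dWaveFormFactor L)) (2 * F.card) 0 φ) :
    a ≤ (star φ ⬝ᵥ ((pairField dWaveFormFactor L)ᴴ * pairField dWaveFormFactor L) *ᵥ φ).re := by
  refine crutch_groundState_order_ge_of_trial 0 F.card ht hΨK hΨ0 ?_ hφ1 hφ
  rw [minEnergyOn_szSector_free_eq hL F μ hF hF']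
  exact hΨ

omit [NeZero L] in
/-- **Corollary (long-range order from trial states along the axis).** If for all large even sides
the sector `(2⌊(1-δ)L²/2⌋, 0)` contains a nonzero `Ψ_L` with
`re⟨Ψ_L, H_L(g)Ψ_L⟩ ≤ (min_{K_L} H_L - κL²)‖Ψ_L‖²`, `H_L(g) = H_L - (g/L²)ΔᴴΔ`, then every family
of normalised sector ground states of `H_L(g)` has `d`-wave long-range order in the summit's exact
sense (order `≥ (κ/g)L⁴` at every large even side). [this work] -/
theorem crutch_hasLongRangeOrder_of_trials (U : ℝ) {δ : ℝ} {g κ : ℝ} (hg : 0 < g) (hκ : 0 < κ)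
    {L₁ : ℕ}
    (htrial : ∀ m : ℕ, Even (m + 1) → L₁ ≤ m + 1 → ∃ Ψ : Fock (Orb (FermionTorus 2 (m + 1))),
      Ψ ∈ szSector (Λ := FermionTorus 2 (m + 1)) (2 * ⌊(1 - δ) * ((m + 1 : ℕ) : ℝ) ^ 2 / 2⌋₊) 0 ∧
        Ψ ≠ 0 ∧
        (star Ψ ⬝ᵥ (hubbardTorus 2 (m + 1) 1 U + ((-(g / ((m + 1 : ℕ) : ℝ) ^ 2) : ℝ) : ℂ) •
            ((pairField dWaveFormFactor (m + 1))ᴴ * pairField dWaveFormFactor (m + 1))) *ᵥ Ψ).re ≤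
          ((hubbardTorus 2 (m + 1) 1 U).minEnergyOn
              (szSector (Λ := FermionTorus 2 (m + 1)) (2 * ⌊(1 - δ) * ((m + 1 : ℕ) : ℝ) ^ 2 / 2⌋₊) 0)
            - κ * ((m + 1 : ℕ) : ℝ) ^ 2) * (star Ψ ⬝ᵥ Ψ).re)
    (ψ : ∀ L, Fock (Orb (FermionTorus 2 L)))
    (hψ : ∀ m : ℕ, Even (m + 1) → star (ψ (m + 1)) ⬝ᵥ ψ (m + 1) = 1 ∧
      IsGroundStateInSector
        (hubbardTorus 2 (m + 1) 1 U + ((-(g / ((m + 1 : ℕ) : ℝ) ^ 2) : ℝ) : ℂ) •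
          ((pairField dWaveFormFactor (m + 1))ᴴ * pairField dWaveFormFactor (m + 1)))
        (2 * ⌊(1 - δ) * ((m + 1 : ℕ) : ℝ) ^ 2 / 2⌋₊) 0 (ψ (m + 1))) :
    HasLongRangeOrder (fun k => halfOpenBox 2 (2 * k))
      (fun k => torusPullback (pairFieldCorr dWaveFormFactor ψ) (2 * k)) := by
  refine hasLongRangeOrder_even_of_le dWaveFormFactor ψ (fun m hm => (hψ m hm).1)
    (a := κ / g) (by positivity) L₁ fun m hm hKm => ?_
  rw [sum_pairFieldCorr_succ]
  obtain ⟨hψ1, hgs⟩ := hψ m hm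
  obtain ⟨Ψ, hΨK, hΨ0, hΨ⟩ := htrial m hm hKm
  have hL0 : (0 : ℝ) < ((m + 1 : ℕ) : ℝ) := by positivity
  have ht : 0 < g / ((m + 1 : ℕ) : ℝ) ^ 2 := by positivity
  have key := crutch_groundState_order_ge_of_trial (L := m + 1) U _ ht hΨK hΨ0
    (a := κ / g * ((m + 1 : ℕ) : ℝ) ^ 4) ?_ hψ1 hgs
  · simpa only [expect] using key
  · have h1 : g / ((m + 1 : ℕ) : ℝ) ^ 2 * (κ / g * ((m + 1 : ℕ) : ℝ) ^ 4) =
        κ * ((m + 1 : ℕ) : ℝ) ^ 2 := by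
      field_simp
    rw [h1]
    exact hΨ

end Summit.HubbardSuperconductivity.HubbardSuperconductivity.Theorems.CrutchAxis
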